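import Mathlib.Combinatorics.SimpleGraph.Finite
import Mathlib.Topology.Order.Lattice
import Literature.Geometry.DiscreteGeometry.KissingNumberThreeProofs
import HarnessLib

/-!
# Flatley–Theil 2015, Proposition 3.3.1 (`#N(x) ≤ 12` for `α < α₀`, the perturbed kissing bound)
and Lemma 5.8: the two elementary label-counting bounds
`(n − #X₁₂) ≤ m(1) n − #𝒩 ≤ m(1)(n − #X₁₂)` and `#(X_reg ∖ X_reg²) ≤ 12 (n − #X_reg)` — proof

Topic `Literature/MathematicalPhysics/StatisticalMechanics`; companion of
`FlatleyTheil2015Crystallization.lean` (L. Flatley, F. Theil, *Face-centered cubic crystallization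
of atomistic configurations*, Arch. Ration. Mech. Anal. **218** (2015) 363–416 = arXiv:1407.0692,
read in the held arXiv source, lit store `paper:arxiv-1407.0692`) and of
`Literature/Geometry/DiscreteGeometry/KissingNumberThreeProofs.lean` (the kissing number theorem
`musin2006_kissing_three_holds`, which supplies the neighbour bound at `α = 0`). Everything in
this file is PROVED (no definition, no named fact; D-0026).

## Source, as printed (arXiv source; equation labels are the authors' TeX labels)

§2, (2.5) [`(eq:S)`]: "`𝒩 := {(x, x') ∈ X × X : ||y(x') − y(x)| − 1| ≤ α}`" (ORDERED pairs);
§3: "`N(x) := {x' ∈ X : (x, x') ∈ 𝒩}`"; Definition 3.6: "`X₁₂ = {x ∈ X : #N(x) = 12}`,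
`X_reg = {x ∈ X₁₂ : ½ #A(x) = 24}`, …" and "`X_reg² = {x ∈ X_reg : N(x) ⊂ X_reg}`"; §5 (proof of
Lemma 5.8): "`m(1) = 12, m(√2) = 6, m(√3) = 24`"; Proposition 2.6's display (eq:mindist):
"`min_{x, x' ∈ X, x ≠ x'} |y(x') − y(x)| > 1 − α`".

**Proposition 3.3** (Local neighborhoods). "There exists a constant `α₀ > 0` such that for all
`α ∈ (0, α₀)` and and all configurations `y : X → ℝ³` satisfying the minimum distance bound
(eq:mindist) the following statements are true. 1. `#N(x) ≤ 12` and `½ #𝒜(x) ≤ 24` for all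
`x ∈ X`. 2. [the rigidity clause] …" Proof (§3.1): "The proof of statements 1 and 2 is an
immediate consequence of Theorems 3.4 [the kissing problem, `k(3) = 12`] & 3.5 [24 contacts,
[HarTayThe]] and standard compactness arguments."

**Lemma 5.8.** "There exists constants `C, α₀ ≥ 0` such that for every `α ∈ (0, α₀)`, every
configuration `y : X → ℝ³` satisfying the minimum distance bound (eq:mindist) and every
`λ ∈ Λ_long`, the estimate `0 ≤ (m(λ)/m(1)) #𝒩 − #P(λ) ≤ C λ³ #∂X` holds. Let `n = #X`. Then the
short- and medium-range pairs satisfy the bounds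
`(n − #X₁₂) ≤ m(1) n − #𝒩 ≤ m(1)(n − #X₁₂)`, (nnbound)
`#(X_reg ∖ X_reg²) ≤ 12 (n − #X_reg)`, (eq:X2)
`|m(√2) n − #P(√2)| ≤ C(n − #X_reg)`, `|#P(√(8/3)) − 2 #X_oct²| ≤ C(n − #X_reg)`,
`0 ≤ #P(√3) − m(√3) #X_co² − 18 #X_oct² ≤ C(n − #X_reg)`.
The proof can be found in the appendix."
Appendix, *Short- and medium-range pairs*: "The proof of (nnbound) is immediate:
`#𝒩 = Σ_{x∈X} #N(x) = Σ_{x∈X₁₂} #N(x) + Σ_{x∈X∖X₁₂} #N(x) = m(1) #X − Σ_{x∈X∖X₁₂} (m(1) − #N(x))`.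
Proposition (prop:maxnhd) implies that `1 ≤ m(1) − #N(x) ≤ m(1)` in the last sum, therefore
(nnbound) holds. Inequality (eq:X2) is the result of a simple estimate:
`#(X_reg ∖ X_reg²) ≤ Σ_{x∈X_reg} #(N(x) ∩ (X ∖ X_reg)) = Σ_{x∈X∖X_reg} #(N(x) ∩ X_reg) ≤ 12 (n − #X_reg)`."

## Rendering and what is proved

Both printed bounds are statements about a finite SYMMETRIC neighbour relation with at most
`m(1) = 12` neighbours per label; nothing else about `y` enters their proofs. We prove them for
an arbitrary finite simple graph `G` on the label type — FT's `𝒩` is symmetric and irreflexive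
(`α < 1`), `N(x)` is `G.neighborFinset x`, `#N(x) = G.degree x`, `#𝒩 = Σ_x #N(x)` — with the
neighbour bound `∀ x, #N(x) ≤ m` as the explicit hypothesis (`m = 12` in the paper):
* `FlatleyTheil2015.card_orderedPairs_eq_sum_degree` — `#𝒩 = Σ_x #N(x)` (ordered pairs);
* `FlatleyTheil2015.nnbound` — (nnbound), stated in `ℤ` (no truncated subtraction):
  `(n − #X_m) ≤ m n − Σ_x #N(x) ≤ m (n − #X_m)` with `X_m = {x : #N(x) = m}`;
* `FlatleyTheil2015.card_not_nbhd_subset_le` — (eq:X2) for an ARBITRARY label set `R` in place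
  of `X_reg` (the printed three-step estimate uses only `R ⊆ X` and the neighbour bound; `X_reg`
  itself needs `A(x)` and is not required here): `#{x ∈ R : N(x) ⊄ R} ≤ m (n − #R)`;
* `FlatleyTheil2015.degree_le_twelve_of_one_le_dist` — the hypothesis at `α = 0` from the tree's
  kissing number theorem: for a configuration with pairwise distances `≥ 1` and `G` the graph of
  (2.5) at `α = 0` (`x ∼ x' ↔ x ≠ x' ∧ |y(x') − y(x)| = 1`), `#N(x) ≤ 12`; whence
  `FlatleyTheil2015.nnbound_of_one_le_dist` and `FlatleyTheil2015.card_not_nbhd_subset_le_of_one_le_dist`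
  = (nnbound) and (eq:X2) with `m(1) = 12` UNCONDITIONALLY at `α = 0`;
* **Proposition 3.3.1, the clause `#N(x) ≤ 12`, for `α < α₀` — PROVED** (section
  `PerturbedKissing`, the paper's "standard compactness argument" made explicit):
  `FlatleyTheil2015.exists_forall_thirteen_annulus_false` / `exists_card_le_twelve_annulus`
  (∃ `α₀ > 0`, ∀ `α < α₀`: at most twelve points of `ℝ³` in the annulus `1 − α ≤ |v| ≤ 1 + α`
  with pairwise distances `≥ 1 − α`), `exists_card_nbhd_le_twelve` (AS PRINTED: ∃ `α₀ > 0`,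
  ∀ `α < α₀`, ∀ finite `X`, ∀ `y` with (eq:mindist), ∀ `x`, `#N(x) ≤ 12`, the constant `α₀`
  uniform in `X` and `y`), `exists_degree_le_twelve` (the same as a degree bound for the graph
  of (2.5)); whence `exists_nnbound` and `exists_card_not_nbhd_subset_le` = (nnbound) and
  (eq:X2) for all `α < α₀` exactly as printed, with no extra hypothesis. The other clause of
  3.3.1, `½ #𝒜(x) ≤ 24`, is Theorem 3.5 (computer-assisted, [HarTayThe]; tree: the named fact
  `FlatleyEtAl2013_maxContacts`) and is not touched; clause 3.3.2 (local fcc/hcp rigidity) is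
  not formalized.
Graphs enter through an adjacency hypothesis `hG`, not through a new definition. The last three
bounds of Lemma 5.8 (`P(√2)`, `P(√(8/3))`, `P(√3)`) need the reference-configuration machinery of
§5 and are not formalized here. Mathlib input beyond finite sums: `Continuous.finset_sup'_apply`,
`IsCompact.exists_isMinOn` on a closed ball of the proper space `(ℝ³)¹³` (sup norm).
-/

noncomputable section

open Finset
open scoped BigOperators

namespace Literature.MathematicalPhysics.StatisticalMechanics

namespace FlatleyTheil2015

variable {ι : Type*} [Fintype ι]

/-- `#𝒩 = Σ_x #N(x)` for the set of ORDERED neighbour pairs `𝒩 = {(x, x') : x ∼ x'}` — the first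
equality of the printed proof of (nnbound), linking the pair count of the statement to the degree
sum used below. [cite: FlatleyTheil2015, Appendix, proof of Lemma 5.8 (nnbound), first equality] -/
theorem card_orderedPairs_eq_sum_degree (G : SimpleGraph ι) [DecidableRel G.Adj] :
    ((univ : Finset (ι × ι)).filter fun p => G.Adj p.1 p.2).card = ∑ x, G.degree x := by
  classical
  rw [card_filter, ← Finset.univ_product_univ, Finset.sum_product]
  refine Finset.sum_congr rfl fun x _ => ?_
  rw [← G.card_neighborFinset_eq_degree, SimpleGraph.neighborFinset_eq_filter, card_filter]

/-- **Flatley–Theil 2015, Lemma 5.8 (nnbound)** for a finite symmetric neighbour relation with at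
most `m` neighbours per label: `(n − #X_m) ≤ m·n − Σ_x #N(x) ≤ m·(n − #X_m)`, where
`X_m = {x : #N(x) = m}` (`m = m(1) = 12`, `X_m = X₁₂`, `Σ_x #N(x) = #𝒩` in the paper). Stated in
`ℤ`. Proof as printed: `Σ_x #N(x) = m #X − Σ_{x ∉ X_m} (m − #N(x))` with `1 ≤ m − #N(x) ≤ m` there.
[cite: FlatleyTheil2015, Lemma 5.8, estimate (nnbound) (first line of its second display); proof: Appendix, "Short- and medium-range pairs"] -/
theorem nnbound (G : SimpleGraph ι) [DecidableRel G.Adj] (m : ℕ) (h : ∀ x, G.degree x ≤ m) :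
    ((Fintype.card ι : ℤ) - ((univ.filter fun x => G.degree x = m).card : ℤ)
        ≤ (m : ℤ) * Fintype.card ι - ∑ x, (G.degree x : ℤ)) ∧
    ((m : ℤ) * Fintype.card ι - ∑ x, (G.degree x : ℤ)
        ≤ (m : ℤ) * ((Fintype.card ι : ℤ) - ((univ.filter fun x => G.degree x = m).card : ℤ))) := by
  set S : Finset ι := univ.filter fun x => G.degree x = m with hS
  set U : Finset ι := univ.filter fun x => ¬G.degree x = m with hU
  have hcard : (S.card : ℤ) + U.card = Fintype.card ι := by
    rw [hS, hU]
    exact_mod_cast Finset.card_filter_add_card_filter_not (s := (univ : Finset ι))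
      (fun x => G.degree x = m)
  have hsum : ∑ x, (G.degree x : ℤ) = ∑ x ∈ S, (G.degree x : ℤ) + ∑ x ∈ U, (G.degree x : ℤ) := by
    rw [hS, hU, Finset.sum_filter_add_sum_filter_not]
  have hS' : ∑ x ∈ S, (G.degree x : ℤ) = (m : ℤ) * S.card := by
    rw [Finset.sum_congr rfl (g := fun _ => (m : ℤ)) (fun x hx => by
      rw [hS, mem_filter] at hx; exact_mod_cast hx.2)]
    rw [sum_const, nsmul_eq_mul, mul_comm]
  have hU1 : ∑ x ∈ U, (G.degree x : ℤ) + U.card ≤ (m : ℤ) * U.card := by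
    have hle : ∀ x ∈ U, (G.degree x : ℤ) + 1 ≤ m := fun x hx => by
      rw [hU, mem_filter] at hx
      have h2 : G.degree x < m := lt_of_le_of_ne (h x) hx.2
      omega
    have h3 := sum_le_sum hle
    rw [sum_add_distrib, sum_const, sum_const, nsmul_eq_mul, nsmul_eq_mul, mul_one] at h3
    linarith [mul_comm (U.card : ℤ) (m : ℤ)]
  have hU0 : 0 ≤ ∑ x ∈ U, (G.degree x : ℤ) := sum_nonneg fun x _ => by positivity
  have hmn : (m : ℤ) * Fintype.card ι = (m : ℤ) * S.card + (m : ℤ) * U.card := by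
    rw [← hcard]; ring
  have hdist : (m : ℤ) * ((Fintype.card ι : ℤ) - (S.card : ℤ)) =
      (m : ℤ) * Fintype.card ι - (m : ℤ) * S.card := by ring
  constructor
  · linarith
  · linarith

/-- **Flatley–Theil 2015, Lemma 5.8 (eq:X2)**, for an arbitrary label set `R` (the paper's
`R = X_reg`, for which `{x ∈ R : N(x) ⊄ R} = X_reg ∖ X_reg²`): with at most `m` neighbours per
label, `#{x ∈ R : N(x) ⊄ R} ≤ m · (n − #R)`. Proof as printed:
`≤ Σ_{x∈R} #(N(x) ∩ (X ∖ R)) = Σ_{x∈X∖R} #(N(x) ∩ R) ≤ m (n − #R)` (symmetry of the relation in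
the middle step). [cite: FlatleyTheil2015, Lemma 5.8, estimate (eq:X2) (second line of its second display); proof: Appendix, "Short- and medium-range pairs"] -/
theorem card_not_nbhd_subset_le [DecidableEq ι] (G : SimpleGraph ι) [DecidableRel G.Adj] (m : ℕ)
    (h : ∀ x, G.degree x ≤ m) (R : Finset ι) :
    (R.filter fun x => ¬G.neighborFinset x ⊆ R).card ≤ m * (Fintype.card ι - R.card) := by
  classical
  -- each label of the left-hand set has a neighbour outside `R`
  have h1 : (R.filter fun x => ¬G.neighborFinset x ⊆ R).card ≤
      ∑ x ∈ R, (Rᶜ.filter fun x' => G.Adj x x').card := by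
    calc (R.filter fun x => ¬G.neighborFinset x ⊆ R).card
        = ∑ x ∈ R.filter (fun x => ¬G.neighborFinset x ⊆ R), 1 := by rw [card_eq_sum_ones]
      _ ≤ ∑ x ∈ R.filter (fun x => ¬G.neighborFinset x ⊆ R),
            (Rᶜ.filter fun x' => G.Adj x x').card := by
          apply sum_le_sum
          intro x hx
          rw [mem_filter] at hx
          obtain ⟨x', hx'N, hx'R⟩ := not_subset.1 hx.2
          refine Nat.one_le_iff_ne_zero.2 (card_ne_zero.2 ⟨x', ?_⟩)
          rw [mem_filter, mem_compl]
          exact ⟨hx'R, (G.mem_neighborFinset x x').1 hx'N⟩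
      _ ≤ ∑ x ∈ R, (Rᶜ.filter fun x' => G.Adj x x').card :=
          sum_le_sum_of_subset_of_nonneg (filter_subset _ _) fun _ _ _ => Nat.zero_le _
  -- double counting of the pairs `(x, x') ∈ R × (X ∖ R)` with `x ∼ x'`
  have h2 : ∑ x ∈ R, (Rᶜ.filter fun x' => G.Adj x x').card =
      ∑ x' ∈ Rᶜ, (R.filter fun x => G.Adj x x').card := by
    simp_rw [card_filter]
    exact sum_comm
  -- `#(N(x') ∩ R) ≤ #N(x') ≤ m`
  have h3 : ∀ x', (R.filter fun x => G.Adj x x').card ≤ m := fun x' => by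
    refine le_trans (card_le_card fun x hx => ?_) ((G.card_neighborFinset_eq_degree x').le.trans (h x'))
    rw [mem_filter] at hx
    rw [SimpleGraph.mem_neighborFinset]
    exact hx.2.symm
  calc (R.filter fun x => ¬G.neighborFinset x ⊆ R).card
      ≤ ∑ x ∈ R, (Rᶜ.filter fun x' => G.Adj x x').card := h1
    _ = ∑ x' ∈ Rᶜ, (R.filter fun x => G.Adj x x').card := h2
    _ ≤ ∑ x' ∈ Rᶜ, m := sum_le_sum fun x' _ => h3 x'
    _ = m * (Fintype.card ι - R.card) := by rw [sum_const, smul_eq_mul, card_compl, mul_comm]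

/-- **The neighbour bound at `α = 0`** (Proposition 3.3.1 of the paper at `α = 0` is the
kissing number theorem): for labels with pairwise distances `≥ 1` and the edge set (2.5) at
`α = 0`, `x ∼ x' ↔ x ≠ x' ∧ |y(x') − y(x)| = 1`, every label has at most `12` neighbours — the
neighbours, translated by `−y(x)`, are unit vectors with pairwise distances `≥ 1`, so the tree's
`musin2006_kissing_three_holds` applies.
[cite: FlatleyTheil2015, Proposition 3.3.1 at α = 0 (there from Theorem 3.4, `k(3) = 12`)]
[cite: Musin2005, Theorem (k(3) = 12), via `musin2006_kissing_three_holds`] -/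
theorem degree_le_twelve_of_one_le_dist (y : ι → EuclideanSpace ℝ (Fin 3))
    (hsep : ∀ x x', x ≠ x' → 1 ≤ dist (y x) (y x')) (G : SimpleGraph ι) [DecidableRel G.Adj]
    (hG : ∀ x x', G.Adj x x' ↔ x ≠ x' ∧ ‖y x' - y x‖ = 1) (x : ι) : G.degree x ≤ 12 := by
  classical
  have hinj : Set.InjOn (fun x' => y x' - y x) (G.neighborFinset x : Set ι) := by
    intro a _ b _ hab
    by_contra hne
    have h1 := hsep a b hne
    have : y a = y b := sub_left_injective hab
    rw [this, dist_self] at h1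
    exact absurd h1 (by norm_num)
  have hcard : ((G.neighborFinset x).image fun x' => y x' - y x).card = G.degree x := by
    rw [card_image_of_injOn hinj, G.card_neighborFinset_eq_degree]
  rw [← hcard]
  refine Literature.Geometry.DiscreteGeometry.musin2006_kissing_three_holds _ ?_ ?_
  · intro v hv
    obtain ⟨x', hx', rfl⟩ := mem_image.1 hv
    exact ((hG x x').1 ((G.mem_neighborFinset x x').1 hx')).2
  · intro v hv w hw hvw
    obtain ⟨a, ha, rfl⟩ := mem_image.1 hv
    obtain ⟨b, hb, rfl⟩ := mem_image.1 hw
    have hab : a ≠ b := fun e => hvw (by rw [e])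
    have hd := hsep a b hab
    rw [dist_eq_norm, show y a - y x - (y b - y x) = y a - y b by abel]
    rwa [dist_eq_norm] at hd

/-- **Lemma 5.8 (nnbound) at `α = 0`, unconditionally** (`m(1) = 12`): for labels with pairwise
distances `≥ 1` and the edge set (2.5) at `α = 0`,
`(n − #X₁₂) ≤ 12 n − #𝒩 ≤ 12 (n − #X₁₂)` (in `ℤ`; `#𝒩 = Σ_x #N(x)`).
[cite: FlatleyTheil2015, Lemma 5.8 (nnbound) with Proposition 3.3.1 at α = 0] -/
theorem nnbound_of_one_le_dist (y : ι → EuclideanSpace ℝ (Fin 3))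
    (hsep : ∀ x x', x ≠ x' → 1 ≤ dist (y x) (y x')) (G : SimpleGraph ι) [DecidableRel G.Adj]
    (hG : ∀ x x', G.Adj x x' ↔ x ≠ x' ∧ ‖y x' - y x‖ = 1) :
    ((Fintype.card ι : ℤ) - ((univ.filter fun x => G.degree x = 12).card : ℤ)
        ≤ (12 : ℤ) * Fintype.card ι - ∑ x, (G.degree x : ℤ)) ∧
    ((12 : ℤ) * Fintype.card ι - ∑ x, (G.degree x : ℤ)
        ≤ (12 : ℤ) * ((Fintype.card ι : ℤ) - ((univ.filter fun x => G.degree x = 12).card : ℤ))) := by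
  exact_mod_cast nnbound G 12 (degree_le_twelve_of_one_le_dist y hsep G hG)

/-- **Lemma 5.8 (eq:X2) at `α = 0`, unconditionally**: for labels with pairwise distances `≥ 1`,
the edge set (2.5) at `α = 0` and any label set `R` (the paper's `X_reg`),
`#{x ∈ R : N(x) ⊄ R} ≤ 12 (n − #R)`.
[cite: FlatleyTheil2015, Lemma 5.8 (eq:X2) with Proposition 3.3.1 at α = 0] -/
theorem card_not_nbhd_subset_le_of_one_le_dist [DecidableEq ι] (y : ι → EuclideanSpace ℝ (Fin 3))
    (hsep : ∀ x x', x ≠ x' → 1 ≤ dist (y x) (y x')) (G : SimpleGraph ι) [DecidableRel G.Adj]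
    (hG : ∀ x x', G.Adj x x' ↔ x ≠ x' ∧ ‖y x' - y x‖ = 1) (R : Finset ι) :
    (R.filter fun x => ¬G.neighborFinset x ⊆ R).card ≤ 12 * (Fintype.card ι - R.card) :=
  card_not_nbhd_subset_le G 12 (degree_le_twelve_of_one_le_dist y hsep G hG) R

/-! ## Proposition 3.3.1, first clause (`#N(x) ≤ 12` for `α < α₀`): the perturbed kissing bound

Printed (§3): "**Proposition 3.3** (Local neighborhoods). There exists a constant `α₀ > 0` such
that for all `α ∈ (0, α₀)` and and all configurations `y : X → ℝ³` satisfying the minimum distance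
bound (eq:mindist) the following statements are true. 1. `#N(x) ≤ 12` and `½ #𝒜(x) ≤ 24` for all
`x ∈ X`. 2. …"; "(eq:mindist)" is Proposition 2.6's display
"`min_{x, x' ∈ X, x ≠ x'} |y(x') − y(x)| > 1 − α`"; proof (§3.1): "The proof of statements 1 and 2
is an immediate consequence of Theorems 3.4 [`k(3) = 12`] & 3.5 and standard compactness
arguments." We prove the clause `#N(x) ≤ 12` (the clause `½ #𝒜(x) ≤ 24` is Theorem 3.5, the
computer-assisted contact-graph bound of [HarTayThe]; tree: the named fact
`FlatleyEtAl2013_maxContacts`, not touched here). The compactness argument, made explicit: on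
the compact box `{p ∈ (ℝ³)¹³ : ‖p‖_∞ ≤ 2}` the continuous function
`Φ(p) = max (maxᵢ |‖pᵢ‖ − 1|, max_{i ≠ j} (1 − ‖pᵢ − pⱼ‖))` is everywhere positive — `Φ(p) ≤ 0`
would exhibit thirteen unit vectors with pairwise distances `≥ 1`, against `k(3) = 12` — hence
bounded below by some `α₁ > 0`; for `α < α₀ := min α₁ 1`, thirteen points in the annulus
`[1 − α, 1 + α]` with pairwise distances `≥ 1 − α` would lie in the box and give `Φ ≤ α < α₁`. -/

section PerturbedKissing

/-- Thirteen unit vectors of `ℝ³` with pairwise distances `≥ 1` do not exist — the kissing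
number theorem `k(3) = 12` (tree: `musin2006_kissing_three_holds`) in indexed form.
[cite: Musin2005, k(3) = 12, via `musin2006_kissing_three_holds`] -/
theorem thirteen_unit_vectors_false (p : Fin 13 → EuclideanSpace ℝ (Fin 3))
    (h1 : ∀ i, ‖p i‖ = 1) (h2 : ∀ i j, i ≠ j → 1 ≤ ‖p i - p j‖) : False := by
  classical
  have hinj : Function.Injective p := by
    intro i j hij
    by_contra hne
    have h := h2 i j hne
    rw [hij, sub_self, norm_zero] at h
    linarith
  have hcard : (univ.image p).card = 13 := by
    rw [card_image_of_injective _ hinj, card_univ, Fintype.card_fin]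
  have h12 : (univ.image p).card ≤ 12 :=
    Literature.Geometry.DiscreteGeometry.musin2006_kissing_three_holds (univ.image p)
      (fun v hv => by
        obtain ⟨i, -, rfl⟩ := mem_image.1 hv
        exact h1 i)
      (fun v hv w hw hvw => by
        obtain ⟨i, -, rfl⟩ := mem_image.1 hv
        obtain ⟨j, -, rfl⟩ := mem_image.1 hw
        rw [dist_eq_norm]
        exact h2 i j fun e => hvw (by rw [e]))
  omega

/-- The functional `Φ(p) = max (maxᵢ |‖pᵢ‖ − 1|, max_{i ≠ j} (1 − ‖pᵢ − pⱼ‖))` of the compactness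
argument, packaged by its three properties: continuity; `Φ(p) ≤ α` for thirteen points in the
`α`-annulus with pairwise distances `≥ 1 − α`; `Φ(p) ≤ 0` forces unit vectors pairwise `≥ 1`
apart. [folklore] -/
private theorem exists_annulus_functional :
    ∃ Φ : (Fin 13 → EuclideanSpace ℝ (Fin 3)) → ℝ, Continuous Φ ∧
      (∀ p (α : ℝ), (∀ i, |‖p i‖ - 1| ≤ α) → (∀ i j, i ≠ j → 1 - α ≤ ‖p i - p j‖) → Φ p ≤ α) ∧
      (∀ p, Φ p ≤ 0 → (∀ i, ‖p i‖ = 1) ∧ ∀ i j, i ≠ j → 1 ≤ ‖p i - p j‖) := by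
  classical
  have hne₁ : (univ : Finset (Fin 13)).Nonempty := univ_nonempty
  have hne₂ : ((univ : Finset (Fin 13)).offDiag).Nonempty :=
    ⟨(0, 1), mem_offDiag.2 ⟨mem_univ _, mem_univ _, by decide⟩⟩
  -- the two partial maxima
  obtain ⟨Φ₁, hΦ₁c, hΦ₁le, hΦ₁ge⟩ : ∃ Φ₁ : (Fin 13 → EuclideanSpace ℝ (Fin 3)) → ℝ, Continuous Φ₁ ∧
      (∀ p (α : ℝ), (∀ i, |‖p i‖ - 1| ≤ α) → Φ₁ p ≤ α) ∧ ∀ p i, |‖p i‖ - 1| ≤ Φ₁ p := by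
    refine ⟨fun p => univ.sup' hne₁ fun i => |‖p i‖ - 1|, ?_, ?_, ?_⟩
    · exact Continuous.finset_sup'_apply hne₁ fun i _ =>
        ((continuous_apply i).norm.sub continuous_const).abs
    · exact fun p α h => Finset.sup'_le _ _ fun i _ => h i
    · intro p i
      have h := Finset.le_sup' (fun i => |‖p i‖ - 1|) (mem_univ i)
      exact h
  obtain ⟨Φ₂, hΦ₂c, hΦ₂le, hΦ₂ge⟩ : ∃ Φ₂ : (Fin 13 → EuclideanSpace ℝ (Fin 3)) → ℝ, Continuous Φ₂ ∧
      (∀ p (α : ℝ), (∀ i j, i ≠ j → 1 - α ≤ ‖p i - p j‖) → Φ₂ p ≤ α) ∧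
      ∀ p i j, i ≠ j → 1 - ‖p i - p j‖ ≤ Φ₂ p := by
    refine ⟨fun p => (univ : Finset (Fin 13)).offDiag.sup' hne₂ fun q => 1 - ‖p q.1 - p q.2‖,
      ?_, ?_, ?_⟩
    · exact Continuous.finset_sup'_apply hne₂ fun q _ =>
        continuous_const.sub (((continuous_apply q.1).sub (continuous_apply q.2)).norm)
    · intro p α h
      refine Finset.sup'_le _ _ fun q hq => ?_
      have h' := h q.1 q.2 (mem_offDiag.1 hq).2.2
      linarith
    · intro p i j hij
      have hmem : (i, j) ∈ (univ : Finset (Fin 13)).offDiag :=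
        mem_offDiag.2 ⟨mem_univ i, mem_univ j, hij⟩
      have h := Finset.le_sup' (fun q : Fin 13 × Fin 13 => 1 - ‖p q.1 - p q.2‖) hmem
      exact h
  refine ⟨fun p => max (Φ₁ p) (Φ₂ p), hΦ₁c.max hΦ₂c,
    fun p α h1 h2 => max_le (hΦ₁le p α h1) (hΦ₂le p α h2), fun p hp => ⟨fun i => ?_, fun i j hij => ?_⟩⟩
  · have h := (hΦ₁ge p i).trans ((le_max_left _ _).trans hp)
    have h' := abs_nonpos_iff.1 h
    linarith
  · have h := (hΦ₂ge p i j hij).trans ((le_max_right _ _).trans hp)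
    linarith

/-- **Compactness core of Proposition 3.3.1.** There is `α₀ > 0` such that for every `α < α₀`
no thirteen points of `ℝ³` lie in the annulus `1 − α ≤ |v| ≤ 1 + α` with pairwise distances
`≥ 1 − α` (indexed form; the points need not be assumed distinct — the separation forces it).
Proof: the continuous functional of `exists_annulus_functional` attains its minimum on the
compact box `‖p‖_∞ ≤ 2`, and that minimum is positive by `thirteen_unit_vectors_false`.
[cite: FlatleyTheil2015, Proposition 3.3.1, proof ("Theorem 3.4 and standard compactness arguments")]
[cite: Musin2005, k(3) = 12, via `musin2006_kissing_three_holds`] -/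
theorem exists_forall_thirteen_annulus_false :
    ∃ α₀ : ℝ, 0 < α₀ ∧ ∀ α : ℝ, α < α₀ → ∀ p : Fin 13 → EuclideanSpace ℝ (Fin 3),
      (∀ i, |‖p i‖ - 1| ≤ α) → (∀ i j, i ≠ j → 1 - α ≤ ‖p i - p j‖) → False := by
  obtain ⟨Φ, hΦc, hΦle, hΦ0⟩ := exists_annulus_functional
  have hΦpos : ∀ p, 0 < Φ p := fun p =>
    lt_of_not_ge fun hle => thirteen_unit_vectors_false p (hΦ0 p hle).1 (hΦ0 p hle).2
  have hK : IsCompact (Metric.closedBall (0 : Fin 13 → EuclideanSpace ℝ (Fin 3)) 2) :=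
    isCompact_closedBall _ _
  obtain ⟨p₀, -, hmin⟩ :=
    hK.exists_isMinOn ⟨0, Metric.mem_closedBall_self (by norm_num)⟩ hΦc.continuousOn
  refine ⟨min (Φ p₀) 1, lt_min (hΦpos p₀) one_pos, fun α hα p h1 h2 => ?_⟩
  have hpK : p ∈ Metric.closedBall (0 : Fin 13 → EuclideanSpace ℝ (Fin 3)) 2 := by
    rw [mem_closedBall_zero_iff, pi_norm_le_iff_of_nonneg (by norm_num : (0 : ℝ) ≤ 2)]
    intro i
    have h := (abs_le.1 (h1 i)).2
    linarith [min_le_right (Φ p₀) 1]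
  have h3 : Φ p₀ ≤ Φ p := (isMinOn_iff.1 hmin) p hpK
  have h4 : Φ p ≤ α := hΦle p α h1 h2
  linarith [min_le_left (Φ p₀) 1]

/-- **The perturbed kissing bound** (the geometric content of Proposition 3.3.1's `#N(x) ≤ 12`):
there is `α₀ > 0` such that for all `α < α₀` at most twelve points of `ℝ³` lie in the annulus
`1 − α ≤ |v| ≤ 1 + α` with pairwise distances `≥ 1 − α`. At `α = 0` this is the kissing number
theorem `k(3) = 12` (Theorem 3.4 of the paper; tree: `musin2006_kissing_three_holds`).
[cite: FlatleyTheil2015, Proposition 3.3.1 with its proof (Theorem 3.4 + compactness)] -/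
theorem exists_card_le_twelve_annulus :
    ∃ α₀ : ℝ, 0 < α₀ ∧ ∀ α : ℝ, α < α₀ → ∀ T : Finset (EuclideanSpace ℝ (Fin 3)),
      (∀ v ∈ T, |‖v‖ - 1| ≤ α) → (∀ v ∈ T, ∀ w ∈ T, v ≠ w → 1 - α ≤ dist v w) → T.card ≤ 12 := by
  classical
  obtain ⟨α₀, hα₀, h⟩ := exists_forall_thirteen_annulus_false
  refine ⟨α₀, hα₀, fun α hα T h1 h2 => ?_⟩
  by_contra hT
  obtain ⟨t, htT, ht⟩ := Finset.exists_subset_card_eq (show 13 ≤ T.card by omega)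
  have e := Finset.equivFinOfCardEq ht
  refine h α hα (fun i => ((e.symm i : t) : EuclideanSpace ℝ (Fin 3)))
    (fun i => h1 _ (htT (e.symm i).2)) fun i j hij => ?_
  have hne : ((e.symm i : t) : EuclideanSpace ℝ (Fin 3)) ≠ (e.symm j : t) := fun hv =>
    hij (e.symm.injective (Subtype.ext hv))
  have := h2 _ (htT (e.symm i).2) _ (htT (e.symm j).2) hne
  rwa [dist_eq_norm] at this

/-- **Proposition 3.3.1, first clause, AS PRINTED**: there is a constant `α₀ > 0` such that for
all `α < α₀` (in particular all `α ∈ (0, α₀)`), every finite label set `X`, every configuration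
`y : X → ℝ³` with the minimum distance bound (eq:mindist) `min_{x ≠ x'} |y(x') − y(x)| > 1 − α`,
and every `x ∈ X`: `#N(x) ≤ 12`, where `N(x) = {x' ∈ X : ||y(x') − y(x)| − 1| ≤ α}` ((2.5), §3).
The second clause `½ #𝒜(x) ≤ 24` (Theorem 3.5, computer-assisted) is NOT proved here.
Proof: `x' ↦ y(x') − y(x)` is injective on `N(x)` by (eq:mindist) (`α < 1`) and maps it to points
of the annulus with pairwise distances `≥ 1 − α`; apply `exists_card_le_twelve_annulus`.
[cite: FlatleyTheil2015, Proposition 3.3.1 (the bound #N(x) ≤ 12)] -/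
theorem exists_card_nbhd_le_twelve :
    ∃ α₀ : ℝ, 0 < α₀ ∧ ∀ α : ℝ, α < α₀ →
      ∀ {X : Type*} [Fintype X] (y : X → EuclideanSpace ℝ (Fin 3)),
      (∀ x x', x ≠ x' → 1 - α < ‖y x' - y x‖) →
      ∀ x, (univ.filter fun x' => |‖y x' - y x‖ - 1| ≤ α).card ≤ 12 := by
  classical
  obtain ⟨α₀, hα₀, h⟩ := exists_card_le_twelve_annulus
  refine ⟨min α₀ 1, lt_min hα₀ one_pos, ?_⟩
  intro α hα X _ y hsep x
  have hα₀' : α < α₀ := hα.trans_le (min_le_left _ _)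
  have hα1 : α < 1 := hα.trans_le (min_le_right _ _)
  have hinj : Set.InjOn (fun x' => y x' - y x)
      ((univ.filter fun x' => |‖y x' - y x‖ - 1| ≤ α : Finset X) : Set X) := by
    intro a _ b _ hab
    by_contra hne
    have hlt := hsep b a (Ne.symm hne)
    have hyab : y a = y b := sub_left_injective hab
    rw [hyab, sub_self, norm_zero] at hlt
    linarith
  rw [← card_image_of_injOn hinj]
  refine h α hα₀' _ ?_ ?_
  · intro v hv
    obtain ⟨a, ha, rfl⟩ := mem_image.1 hv
    exact (mem_filter.1 ha).2
  · intro v hv w hw hvw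
    obtain ⟨a, ha, rfl⟩ := mem_image.1 hv
    obtain ⟨b, hb, rfl⟩ := mem_image.1 hw
    have hab : a ≠ b := fun e => hvw (by rw [e])
    rw [dist_eq_norm, show y a - y x - (y b - y x) = y a - y b by abel]
    exact (hsep b a hab.symm).le

/-- Proposition 3.3.1 as a DEGREE bound for the neighbour graph of (2.5): there is `α₀ > 0`
such that for `α < α₀`, every finite label set `X`, every `y : X → ℝ³` with (eq:mindist) and
every simple graph `G` on `X` with `x ∼ x' ↔ x ≠ x' ∧ ||y(x') − y(x)| − 1| ≤ α` (for `α < 1`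
this is exactly membership in `𝒩`, which is symmetric and irreflexive): `#N(x) = deg x ≤ 12`.
This is the hypothesis `h` of `nnbound` / `card_not_nbhd_subset_le` with `m = m(1) = 12`.
[cite: FlatleyTheil2015, Proposition 3.3.1 (the bound #N(x) ≤ 12)] -/
theorem exists_degree_le_twelve :
    ∃ α₀ : ℝ, 0 < α₀ ∧ ∀ α : ℝ, α < α₀ →
      ∀ {X : Type*} [Fintype X] (y : X → EuclideanSpace ℝ (Fin 3)),
      (∀ x x', x ≠ x' → 1 - α < ‖y x' - y x‖) →
      ∀ (G : SimpleGraph X) [DecidableRel G.Adj],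
      (∀ x x', G.Adj x x' ↔ x ≠ x' ∧ |‖y x' - y x‖ - 1| ≤ α) → ∀ x, G.degree x ≤ 12 := by
  classical
  obtain ⟨α₀, hα₀, h⟩ := exists_card_nbhd_le_twelve
  refine ⟨α₀, hα₀, ?_⟩
  intro α hα X _ y hsep G _ hG x
  refine le_trans ?_ (h α hα y hsep x)
  rw [← G.card_neighborFinset_eq_degree]
  refine card_le_card fun x' hx' => ?_
  rw [mem_filter]
  exact ⟨mem_univ _, ((hG x x').1 ((G.mem_neighborFinset x x').1 hx')).2⟩

/-- **Lemma 5.8 (nnbound) for `α ∈ (0, α₀)`, AS PRINTED (unconditionally)** (`m(1) = 12`): there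
is `α₀ > 0` such that for `α < α₀`, every finite `X`, every `y : X → ℝ³` with (eq:mindist) and
`G` the neighbour graph of (2.5): `(n − #X₁₂) ≤ 12 n − #𝒩 ≤ 12 (n − #X₁₂)` (in `ℤ`;
`#𝒩 = Σ_x #N(x)` by `card_orderedPairs_eq_sum_degree`).
[cite: FlatleyTheil2015, Lemma 5.8 (nnbound) with Proposition 3.3.1] -/
theorem exists_nnbound :
    ∃ α₀ : ℝ, 0 < α₀ ∧ ∀ α : ℝ, α < α₀ →
      ∀ {X : Type*} [Fintype X] (y : X → EuclideanSpace ℝ (Fin 3)),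
      (∀ x x', x ≠ x' → 1 - α < ‖y x' - y x‖) →
      ∀ (G : SimpleGraph X) [DecidableRel G.Adj],
      (∀ x x', G.Adj x x' ↔ x ≠ x' ∧ |‖y x' - y x‖ - 1| ≤ α) →
      ((Fintype.card X : ℤ) - ((univ.filter fun x => G.degree x = 12).card : ℤ)
          ≤ (12 : ℤ) * Fintype.card X - ∑ x, (G.degree x : ℤ)) ∧
      ((12 : ℤ) * Fintype.card X - ∑ x, (G.degree x : ℤ)
          ≤ (12 : ℤ) * ((Fintype.card X : ℤ) - ((univ.filter fun x => G.degree x = 12).card : ℤ))) := by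
  obtain ⟨α₀, hα₀, h⟩ := exists_degree_le_twelve
  refine ⟨α₀, hα₀, ?_⟩
  intro α hα X _ y hsep G _ hG
  exact_mod_cast nnbound G 12 (h α hα y hsep G hG)

/-- **Lemma 5.8 (eq:X2) for `α ∈ (0, α₀)`, AS PRINTED (unconditionally)**: there is `α₀ > 0`
such that for `α < α₀`, every finite `X`, every `y : X → ℝ³` with (eq:mindist), `G` the
neighbour graph of (2.5) and any label set `R` (the paper's `X_reg`):
`#{x ∈ R : N(x) ⊄ R} ≤ 12 (n − #R)`.
[cite: FlatleyTheil2015, Lemma 5.8 (eq:X2) with Proposition 3.3.1] -/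
theorem exists_card_not_nbhd_subset_le :
    ∃ α₀ : ℝ, 0 < α₀ ∧ ∀ α : ℝ, α < α₀ →
      ∀ {X : Type*} [Fintype X] [DecidableEq X] (y : X → EuclideanSpace ℝ (Fin 3)),
      (∀ x x', x ≠ x' → 1 - α < ‖y x' - y x‖) →
      ∀ (G : SimpleGraph X) [DecidableRel G.Adj],
      (∀ x x', G.Adj x x' ↔ x ≠ x' ∧ |‖y x' - y x‖ - 1| ≤ α) → ∀ R : Finset X,
      (R.filter fun x => ¬G.neighborFinset x ⊆ R).card ≤ 12 * (Fintype.card X - R.card) := by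
  obtain ⟨α₀, hα₀, h⟩ := exists_degree_le_twelve
  refine ⟨α₀, hα₀, ?_⟩
  intro α hα X _ _ y hsep G _ hG R
  exact card_not_nbhd_subset_le G 12 (h α hα y hsep G hG) R

end PerturbedKissing

end FlatleyTheil2015

end Literature.MathematicalPhysics.StatisticalMechanics

end
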